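import Summits.ResolutionOfSingularities.ResolutionOfSingularities.Theorems.EquisingularLiftEquisingularLiftNatValuationChartCentre
import Mathlib.RingTheory.Valuation.ValuationSubring
import Mathlib.RingTheory.Valuation.Quotient
import Mathlib.RingTheory.Localization.FractionRing
import HarnessLib

/-!
# [OURS · L1 W4.5(b) · EL♮] K-VAL-CENTRE-UNIQ (U-1): the centre of `v` on the chart `R[J/a]` as a LOCAL HOMOMORPHISM to the
# valuation RING `𝒪_v ⊆ K` — the currency of the tree's centre theorems (`IsBlowup.eq_of_stalkEmb_factors`, `KModel.IsCentre`)
# (crux `EquisingularLiftNat` = stmt-ResolutionOfSingularities-20038; PARENT ≥ 4 band / kill test #50 K5-BMY, DSHARP-VOID §2 (2a))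

HONEST FRAMING. OURS (cell res-hironaka, crux chain w45b, slot W4.5(b)); NOT a statement of any manuscript; replaces the role of
NOTHING in the manuscript; AI-written, AI review is weaker than expert review. Helper `--supports stmt-ResolutionOfSingularities-20038
--as helper`. Object «(U) K-VAL-CENTRE-UNIQ» of res-L1-w45b-plan-1's RULING 2026-08-27T20:06:38Z (res-D-brk-4 g9), piece (U-1) of the
cut announced 20:28:48Z. Sequel of `…NatValuationChartCentre` (p563432) / `…NatValuationCentreBad` (p565158).

WHY. The uniqueness of the centre of a valuation on a blowing up is ALREADY in the tree, in the integral frame and in the currency of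
valuation RINGS: `Literature/…/Resolution/BlowupPointBranches.lean` — `IsBlowup.eq_of_stalkEmb_factors` (two points of `C′` over `x` whose
local rings map LOCALLY to a valuation ring `V ⊆ K(C)` compatibly with the canonical embeddings coincide; `IsSeparated.valuativeCriterion`),
with existence `IsBlowup.exists_point_stalkEmb_mem`; model form `ValuationCentre.lean` `KModel.IsCentre.unique`. The (α) files speak of a
`Γ`-valued valuation `w′ ≤ 1` on the local ring with `w′ < 1` exactly on `𝔪`. This file is the ring-level dictionary between the two:

* `exists_valuation_fractionRing_supp` — the FUNCTION FIELD of the centre: `v` (support `𝔭 = supp v` allowed) induces a valuation `v_K` on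
  `K_v := Frac(R ⧸ 𝔭)` with `v_K (r mod 𝔭) = v r` (Mathlib `Valuation.onQuot` + `extendToLocalization`); so the package below is never vacuous.
* `exists_localHom_valuationSubring` — THE DICTIONARY: for any field `K`, ring map `φ : R → K` and valuation `v_K` of `K` with
  `v_K ∘ φ = v` (e.g. `K = K_v`; or, for an integral scheme and a valuation ring `V ⊆ K(X)` dominating `𝒪_{X,s}`, `K = K(X)`,
  `φ = (𝒪_{X,s} ⊆ K(X))`, `v_K = V.valuation`-like), and the (α) data (`v ≤ 1` on `R`, `v a ≠ 0`, `v ≤ v a` on `J`, `w` the extension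
  to `R[1/a]`, `𝔓_v = {w < 1}` on `R[J/a]`), EVERY localisation `L` of `R[J/a]` at `𝔓_v` (e.g. the stalk `𝒪_{X′,x′}` of p565158's
  compatible reader) admits a LOCAL homomorphism `g : L → 𝒪_{v_K}` to the valuation ring of `v_K`, restricting to `φ` on `R` and
  computing `w`: `v_K (g z) = w z` on `R[J/a]`. With `V.subtype ∘ g` this is exactly the hypothesis shape
  `(g : 𝒪_{C′,x′} →+* V) [IsLocalHom g]` of `IsBlowup.liftStruct_of_stalkEmb_factors` / `eq_of_stalkEmb_factors`.
* `apply_eq_zero_iff_exists` — THE SUPPORT of `w` on `R[J/a]` is the `a`-SATURATION of `𝔭 · R[J/a]` (`w z = 0 ↔ z · aⁿ ∈ 𝔭` for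
  some `n`), i.e. the strict-transform ideal of `V(𝔭)` on the chart (shape of `BlowupAlgebraStrictTransform.mem_ker_blowupAlgebraMap_iff`):
  the centre `𝔓_v ⊇ supp` lies ON THE STRICT TRANSFORM of `V(𝔭)` (`centre_le_of_apply_eq_zero`).

Residual pieces of (U) (announced 20:28:48Z): (U-2) scheme level, integral frame — identify `V.subtype ∘ g` with `IsBlowup.stalkEmb x′`
and conclude with `eq_of_stalkEmb_factors`; (U-3) ambient frame `Y ⊂ P` — strict-transform closed immersion compatibility. Not in this file.

References: O. Zariski, P. Samuel, *Commutative Algebra II*, Ch. VI §5 [ZariskiSamuel1960]; [StacksProject, Tag 00IB, Tag 01KZ];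
tree `…Resolution/BlowupPointBranches.lean`, `…Resolution/ValuationCentre.lean`, `…Resolution/LocalBlowup.lean`.
-/

set_option linter.dupNamespace false -- mandated namespace `Summit.<Summit>.<Problem>` of this single-conjunct summit

noncomputable section

universe u v

open IsLocalRing IsLocalization
open Literature.AlgebraicGeometry.Resolution

namespace Summit.ResolutionOfSingularities.ResolutionOfSingularities.Cruxes.EquisingularLiftNat.Sections

namespace ValChartCentre

variable {R : Type u} [CommRing R] {Γ : Type v} [LinearOrderedCommGroupWithZero Γ]

/-! ## The function field of the centre: `K_v = Frac(R ⧸ supp v)` -/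

/-- **The valuation `v_K` on `K_v := Frac(R ⧸ supp v)` induced by `v`**: `v_K (r mod supp v) = v r`. [folklore] -/
theorem exists_valuation_fractionRing_supp (v : Valuation R Γ) :
    ∃ vK : Valuation (FractionRing (R ⧸ v.supp)) Γ,
      ∀ r : R, vK (algebraMap (R ⧸ v.supp) (FractionRing (R ⧸ v.supp)) (Ideal.Quotient.mk v.supp r)) = v r := by
  let vq : Valuation (R ⧸ v.supp) Γ := v.onQuot le_rfl
  have hvq : ∀ r : R, vq (Ideal.Quotient.mk v.supp r) = v r := fun r => rfl
  have hS : nonZeroDivisors (R ⧸ v.supp) ≤ vq.supp.primeCompl := by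
    intro t ht
    show t ∉ vq.supp
    rw [Valuation.supp_quot_supp]
    exact nonZeroDivisors.ne_zero ht
  refine ⟨vq.extendToLocalization hS (FractionRing (R ⧸ v.supp)), fun r => ?_⟩
  rw [Valuation.extendToLocalization_apply_map_apply]
  exact hvq r

/-! ## The support of `w` on the chart: the `a`-saturation of `supp v` -/

section Away

variable (v : Valuation R Γ) {a : R} {w : Valuation (Localization.Away a) Γ}
  (hw : ∀ r, w (algebraMap R (Localization.Away a) r) = v r)
include hw

/-- **The support of `w` on `R[1/a]` ⊇ `R[J/a]` is the `a`-saturation of `(supp v)`**: `w z = 0` iff `z · aⁿ = x/1` for some `n` and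
some `x ∈ supp v` — on the chart `R[J/a]` this is the strict-transform ideal of `V(supp v)`. [folklore] -/
theorem apply_eq_zero_iff_exists (ha : v a ≠ 0) (z : Localization.Away a) :
    w z = 0 ↔ ∃ n : ℕ, ∃ x ∈ v.supp,
      z * algebraMap R (Localization.Away a) a ^ n = algebraMap R (Localization.Away a) x := by
  constructor
  · intro hz
    obtain ⟨⟨x, s⟩, hzs⟩ := IsLocalization.surj (Submonoid.powers a) z
    obtain ⟨n, hn⟩ := s.2
    have hn' : a ^ n = (s : R) := hn
    refine ⟨n, x, ?_, ?_⟩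
    · rw [Valuation.mem_supp_iff, ← hw x, ← hzs, Valuation.map_mul, hz, zero_mul]
    · rw [← map_pow, hn']
      exact hzs
  · rintro ⟨n, x, hx, hzx⟩
    have hs : v (a ^ n) ≠ 0 := by
      rw [Valuation.map_pow]
      exact pow_ne_zero n ha
    have e : w z * v (a ^ n) = 0 := by
      rw [← hw (a ^ n), ← Valuation.map_mul, map_pow, hzx, hw]
      exact (Valuation.mem_supp_iff v x).mp hx
    exact (mul_eq_zero.mp e).resolve_right hs

variable {J : Ideal R} {𝔓 : Ideal (blowupAlgebra J a)}
  (h𝔓 : ∀ z : blowupAlgebra J a, z ∈ 𝔓 ↔ w (z : Localization.Away a) < 1)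
include h𝔓

omit hw in
/-- The centre `𝔓_v` contains the support of `w` on the chart: it lies ON THE STRICT TRANSFORM of `V(supp v)`. [folklore] -/
theorem centre_le_of_apply_eq_zero (z : blowupAlgebra J a) (hz : w (z : Localization.Away a) = 0) : z ∈ 𝔓 := by
  rw [h𝔓, hz]
  exact zero_lt_one

/-! ## The dictionary: a LOCAL homomorphism to the valuation ring -/

/-- **K-VAL-CENTRE-UNIQ (U-1).** Let `φ : R → K` be a ring map to a field with a valuation `v_K` of `K` such that `v_K ∘ φ = v`, and let
the (α) data be given: `v ≤ 1` on `R`, `v a ≠ 0`, `v ≤ v a` on `J`, `w` the extension of `v` to `R[1/a]`, `𝔓_v = {w < 1}` on `R[J/a]`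
(a prime). Then every localisation `L` of `R[J/a]` at `𝔓_v` admits a LOCAL homomorphism `g : L → 𝒪_{v_K}` to the valuation ring of
`v_K` which restricts to `φ` on `R` and computes `w` on `R[J/a]` (`v_K (g z) = w z`). In particular the maximal ideal of `L` is the
preimage of that of `𝒪_{v_K}` (local hom between local rings): «`L` is dominated by `𝒪_{v_K}`» in the sense of
`IsBlowup.liftStruct_of_stalkEmb_factors` / `eq_of_stalkEmb_factors` / `KModel.IsCentre`. Construction: `σ : R[1/a] → K` (`φ a ≠ 0`),
`v_K ∘ σ = w` by `valuation_away_unique`, `R[J/a] → 𝒪_{v_K}` since `w ≤ 1` there, units off `𝔓_v`, `IsLocalization.lift`. [folklore] -/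
theorem exists_localHom_valuationSubring {K : Type*} [Field K] (φ : R →+* K) (vK : Valuation K Γ)
    (hφ : ∀ r, vK (φ r) = v r) (hR : ∀ r, v r ≤ 1) (ha : v a ≠ 0) (hJ : ∀ x ∈ J, v x ≤ v a) [𝔓.IsPrime]
    (L : Type*) [CommRing L] [IsLocalRing L] [Algebra (blowupAlgebra J a) L] [IsLocalization.AtPrime L 𝔓] :
    ∃ g : L →+* vK.valuationSubring, IsLocalHom g ∧
      (∀ r : R, (g (algebraMap (blowupAlgebra J a) L (algebraMap R (blowupAlgebra J a) r)) : K) = φ r) ∧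
      ∀ z : blowupAlgebra J a, vK (g (algebraMap (blowupAlgebra J a) L z) : K) = w (z : Localization.Away a) := by
  -- `σ : R[1/a] → K`
  have hunit : IsUnit (φ a) := by
    refine isUnit_iff_ne_zero.mpr fun h => ha ?_
    rw [← hφ a, h, Valuation.map_zero]
  let σ : Localization.Away a →+* K := IsLocalization.Away.lift a hunit
  have hσR : ∀ r : R, σ (algebraMap R (Localization.Away a) r) = φ r := fun r =>
    IsLocalization.Away.lift_eq a hunit r
  -- `v_K ∘ σ = w`
  have hσw : ∀ y, vK (σ y) = w y := fun y => by
    have := valuation_away_unique v hw ha (w' := vK.comap σ) (fun r => by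
      rw [Valuation.comap_apply, hσR, hφ]) y
    rwa [Valuation.comap_apply] at this
  -- `ρ : R[J/a] → 𝒪_{v_K}`
  have hint : ∀ z : blowupAlgebra J a, w (z : Localization.Away a) ≤ 1 :=
    fun z => le_one_of_mem_blowupAlgebra v hw hR ha hJ z.2
  have hmem : ∀ z : blowupAlgebra J a, σ (z : Localization.Away a) ∈ vK.valuationSubring := fun z => by
    rw [Valuation.mem_valuationSubring_iff, hσw]
    exact hint z
  let ρ : blowupAlgebra J a →+* vK.valuationSubring :=
    (σ.comp (blowupAlgebra J a).val.toRingHom).codRestrict vK.valuationSubring.toSubring (fun z => hmem z)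
  have hρ : ∀ z : blowupAlgebra J a, (ρ z : K) = σ (z : Localization.Away a) := fun z => rfl
  have hρw : ∀ z : blowupAlgebra J a, vK (ρ z : K) = w (z : Localization.Away a) := fun z => by
    rw [hρ, hσw]
  -- membership in the maximal ideal of `𝒪_{v_K}` is `w < 1`, i.e. membership in `𝔓_v`
  have hρmax : ∀ z : blowupAlgebra J a, ρ z ∈ maximalIdeal vK.valuationSubring ↔ z ∈ 𝔓 := fun z => by
    rw [Valuation.mem_maximalIdeal_iff, hρw, h𝔓]
  -- elements off `𝔓_v` map to units
  have hρunit : ∀ t : 𝔓.primeCompl, IsUnit (ρ t) := fun t => by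
    by_contra h
    have hmem' : ρ t ∈ maximalIdeal vK.valuationSubring := (IsLocalRing.mem_maximalIdeal _).mpr h
    exact t.2 ((hρmax t).mp hmem')
  -- `g : L → 𝒪_{v_K}`
  let g : L →+* vK.valuationSubring := IsLocalization.lift (M := 𝔓.primeCompl) (S := L) hρunit
  have hg : ∀ z : blowupAlgebra J a, g (algebraMap (blowupAlgebra J a) L z) = ρ z := fun z =>
    IsLocalization.lift_eq hρunit z
  refine ⟨g, ⟨fun y hy => ?_⟩, fun r => ?_, fun z => ?_⟩
  · -- local: a unit image forces a unit
    obtain ⟨⟨z, t⟩, rfl⟩ := IsLocalization.mk'_surjective 𝔓.primeCompl y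
    have hspec : IsLocalization.mk' L z t * algebraMap (blowupAlgebra J a) L t =
        algebraMap (blowupAlgebra J a) L z := IsLocalization.mk'_spec L z t
    have hprod : g (IsLocalization.mk' L z t) * ρ t = ρ z := by
      rw [← hg t, ← map_mul, hspec, hg]
    have hz : IsUnit (ρ z) := by
      rw [← hprod]
      exact hy.mul (hρunit t)
    have hz' : z ∉ 𝔓 := fun hzP =>
      (IsLocalRing.mem_maximalIdeal _).mp ((hρmax z).mpr hzP) hz
    exact (IsLocalization.AtPrime.isUnit_mk'_iff L 𝔓 z t).mpr hz'
  · show ((g (algebraMap (blowupAlgebra J a) L (algebraMap R (blowupAlgebra J a) r))) : K) = φ r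
    rw [hg, hρ]
    exact hσR r
  · rw [hg, hρw]

end Away

end ValChartCentre

end Summit.ResolutionOfSingularities.ResolutionOfSingularities.Cruxes.EquisingularLiftNat.Sections
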